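import Summits.KontsevichZagierPeriods.KontsevichZagierPeriods.Theorems.RootDecompWalshStrataFourSym
import Summits.KontsevichZagierPeriods.KontsevichZagierPeriods.Theorems.HurwitzMicroSectorsNormalFormPrincipleDimOneAssembly

/-!
# The weight-one class: quadric cells that descend to the Baker sector are DECIDED

Route `RootDecompWalshStrata` (cell decomp-kz, lens 4, gen 11), support toward `QuadricSignKernel`
(item stmt-KontsevichZagierPeriods-25393).  The tree PROVES Conjecture 1 in kernel form on the rational
sector of dimension `≤ 1` (`PiBox.Dlog.mem_relations_of_eval_eq_zero_of_dim_le_one`, by Baker's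
theorem).  Hence every family of constant-weight quadric cells each of which descends INSIDE the
rules to that sector satisfies the kernel statement of item 25393 OUTRIGHT — no oracle.  This file
types the per-quadric predicate and proves the mechanism and its closure properties:

* `QuadricBakerDescentAt P` — the slice at the quadric `P` (any dimension `d`) of the route item
  `QuadricBakerDescent` (27597) with the bound `d ≤ 3` removed: `[(0,1)^d ∩ {P > 0}, q]` descends to
  the `ℤ`-span of classes of KZ-rational representations of dimension `≤ 1`;
* `quadricBakerDescent_iff` — item 27597 is exactly `∀ d ≤ 3, ∀ P, QuadricBakerDescentAt P`;
* `sum_mem_relations_of_bakerDescentAt` — **THE MECHANISM (proved):** a vanishing `ℤ`-combination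
  of constant-weight quadric cells ALL of whose quadrics satisfy `QuadricBakerDescentAt` is a
  relation (any dimensions, any number of cells);
* `twoDescentFourAt_of_bakerDescentAt` — in dimension `4` the predicate refines the gen-11 node's
  `QuadricTwoDescentFourAt` (`dim ≤ 1 ⊆ dim ≤ 2`);
* closure under the cube's symmetries (`bakerDescentAt_rename`, `bakerDescentAt_reflect`) and under
  cylinders (`bakerDescentAt_cylinder`: `P ↦ rename Fin.castSucc P`, one dimension up), so that with
  item 27597 every degenerate quadric 4-cell is in the class.

The sibling files put the solid paraboloid and the Lorentzian cone (both of weight one: values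
`q·π/15`, `q·π/24`) in the class; the 4-ball (`q·π²/32`) and the split quadric (`q(π²/12 − 3/4)`) are
the weight-two cells left to the oracle `RationalTwoKernel`.  0 sorry.
[KontsevichZagier2001 §1.2; Baker1975 Thm 2.1]
-/

noncomputable section

open Literature.NumberTheory.Transcendental
open MeasureTheory Set
open MvPolynomial (aeval X C rename bind₁)
open Literature.ModelTheory.ExponentialFields (IsSemialgebraic isSemialgebraic_setOf_eval_pos)
open Summit.KontsevichZagierPeriods.RootDecompWalshStrata.WalshSpanProof (isSemialgebraic_cubeSet
  isBounded_cubeSet cellRep cellRep_domain cellRep_integrand)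
open Summit.KontsevichZagierPeriods.RootDecompWalshStrata.QuadricFourRung (QuadricTwoDescentFourAt
  QuadricFour)
open Summit.KontsevichZagierPeriods.RootDecompWalshStrata.FourSym (of_sub_of_cellRep_mem_relations
  reindex_cellRep_rename totalDegree_le_totalDegree_rename cellRep_reflect_domain
  of_cellRep_rename_castSucc_sub_mem_relations)
open Summit.KontsevichZagierPeriods.KontsevichZagierPeriods.Theses.RootDecompWalshStrata
  (QuadricBakerDescent)
open Summit.KontsevichZagierPeriods.HurwitzMicroSectors.NormalFormPrinciple
  (PiBox.Dlog.mem_relations_of_eval_eq_zero_of_dim_le_one)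

namespace Summit.KontsevichZagierPeriods.RootDecompWalshStrata.BakerAt

/-! #### The predicate -/

/-- **`QuadricBakerDescentAt P`** (the WEIGHT-ONE CLASS, per quadric; any dimension `d`): every
representation with domain `(0,1)^d ∩ {P > 0}` and constant rational weight `q` on it descends,
modulo `KZ.relations`, to the `ℤ`-span of classes of KZ-rational representations of dimension `≤ 1`
— the text of item `QuadricBakerDescent` (27597) at a fixed `P`, without the bound `d ≤ 3`.
[KontsevichZagier2001 §1.2] -/
@[conjecture] def QuadricBakerDescentAt {d : ℕ} (P : MvPolynomial (Fin d) ℚ) : Prop :=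
  ∀ (q : ℚ) (ρ : KZ.IntegralRep d),
    (ρ.domain = {x | (∀ j, 0 < x j ∧ x j < 1) ∧ 0 < MvPolynomial.aeval x P} ∧
      ∀ x ∈ ρ.domain, ρ.integrand x = (q : ℝ)) →
    P.totalDegree ≤ 2 →
    ∃ y ∈ AddSubgroup.closure
      {y : KZ.FormalRep | ∃ (m : ℕ) (N : KZ.IntegralRep m), m ≤ 1 ∧ N.IsRational ∧ y = KZ.of N},
      KZ.of ρ - y ∈ KZ.relations

/-- Item 27597 is the conjunction of the slices over `d ≤ 3`. [definition] -/
theorem quadricBakerDescent_iff :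
    QuadricBakerDescent ↔ ∀ d, d ≤ 3 → ∀ P : MvPolynomial (Fin d) ℚ, QuadricBakerDescentAt P :=
  ⟨fun h d hd P q ρ hρ hdeg => h d P q ρ hρ hdeg hd,
    fun h d P q ρ hρ hdeg hd => h d hd P q ρ hρ hdeg⟩

/-- In dimension `4` the weight-one class lies inside the gen-11 node's `QuadricTwoDescentFourAt`
(`dim ≤ 1 ⊆ dim ≤ 2`). [KontsevichZagier2001 §1.2] -/
theorem twoDescentFourAt_of_bakerDescentAt {P : MvPolynomial (Fin 4) ℚ}
    (h : QuadricBakerDescentAt P) : QuadricTwoDescentFourAt P := by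
  intro q ρ hρ hdeg
  obtain ⟨y, hy, hrel⟩ := h q ρ hρ hdeg
  refine ⟨y, AddSubgroup.closure_mono ?_ hy, hrel⟩
  rintro _ ⟨m, N, hm, hN, rfl⟩
  exact ⟨m, N, hm.trans (by norm_num), hN, rfl⟩

/-! #### The mechanism: Baker's theorem decides the weight-one class -/

/-- **THE MECHANISM (proved).** A vanishing `ℤ`-combination of constant-weight quadric cells (any
dimensions `d i`, any number `k` of cells) all of whose quadrics lie in the weight-one class is a
Kontsevich–Zagier relation: descend each cell into the Baker sector; the descended combination has
value `0` (relations evaluate to `0`, `KZ.relations_le_ker_eval_holds`), hence is a relation by the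
tree's kernel theorem in dimension `≤ 1` (`PiBox.Dlog.mem_relations_of_eval_eq_zero_of_dim_le_one`,
Baker); the original combination differs from it by relations.
[Baker1975 Thm 2.1; KontsevichZagier2001 §1.2] -/
theorem sum_mem_relations_of_bakerDescentAt (k : ℕ) (d : Fin k → ℕ)
    (P : (i : Fin k) → MvPolynomial (Fin (d i)) ℚ) (q : Fin k → ℚ)
    (ρ : (i : Fin k) → KZ.IntegralRep (d i)) (c : Fin k → ℤ)
    (hW : ∀ i, QuadricBakerDescentAt (P i))
    (hρ : ∀ i, (ρ i).domain = {x | (∀ j, 0 < x j ∧ x j < 1) ∧ 0 < MvPolynomial.aeval x (P i)} ∧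
      ∀ x ∈ (ρ i).domain, (ρ i).integrand x = (q i : ℝ))
    (hdeg : ∀ i, (P i).totalDegree ≤ 2) (hv : KZ.eval (∑ i, c i • KZ.of (ρ i)) = 0) :
    (∑ i, c i • KZ.of (ρ i)) ∈ KZ.relations := by
  choose y hy hrel using fun i => hW i (q i) (ρ i) (hρ i) (hdeg i)
  have h1 : (∑ i, c i • KZ.of (ρ i)) - ∑ i, c i • y i ∈ KZ.relations := by
    rw [← Finset.sum_sub_distrib]
    exact AddSubgroup.sum_mem _ fun i _ => by
      rw [← smul_sub]; exact AddSubgroup.zsmul_mem _ (hrel i) _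
  have h2 : (∑ i, c i • y i) ∈ AddSubgroup.closure
      {y : KZ.FormalRep | ∃ (m : ℕ) (N : KZ.IntegralRep m), m ≤ 1 ∧ N.IsRational ∧ y = KZ.of N} :=
    AddSubgroup.sum_mem _ fun i _ => AddSubgroup.zsmul_mem _ (hy i) _
  have h3 : KZ.eval (∑ i, c i • y i) = 0 := by
    have h := KZ.relations_le_ker_eval_holds h1
    rw [AddMonoidHom.mem_ker, map_sub, hv, zero_sub, neg_eq_zero] at h
    exact h
  have h4 := PiBox.Dlog.mem_relations_of_eval_eq_zero_of_dim_le_one h2 h3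
  have := KZ.relations.add_mem h1 h4
  simpa using this

/-- **The single-quadric case:** if `P` is in the weight-one class, every vanishing `ℤ`-combination of
representations `[(0,1)^d ∩ {P > 0}, qᵢ]` is a relation. [Baker1975 Thm 2.1; KontsevichZagier2001 §1.2] -/
theorem sum_mem_relations_of_bakerDescentAt_single {d : ℕ} {P : MvPolynomial (Fin d) ℚ}
    (hW : QuadricBakerDescentAt P) (hdeg : P.totalDegree ≤ 2) (k : ℕ) (q : Fin k → ℚ)
    (ρ : Fin k → KZ.IntegralRep d) (c : Fin k → ℤ)
    (hρ : ∀ i, (ρ i).domain = {x | (∀ j, 0 < x j ∧ x j < 1) ∧ 0 < MvPolynomial.aeval x P} ∧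
      ∀ x ∈ (ρ i).domain, (ρ i).integrand x = (q i : ℝ))
    (hv : KZ.eval (∑ i, c i • KZ.of (ρ i)) = 0) :
    (∑ i, c i • KZ.of (ρ i)) ∈ KZ.relations :=
  sum_mem_relations_of_bakerDescentAt k (fun _ => d) (fun _ => P) q ρ c (fun _ => hW) hρ
    (fun _ => hdeg) hv

/-- **If every quadric of dimension `≤ 4` were in the weight-one class, `QuadricFour` would follow
outright** (it is not expected: the 4-ball has weight two). Recorded to fix the logical place of the
class under the gen-11 node. [KontsevichZagier2001 §1.2] -/
theorem quadricFour_of_forall_bakerDescentAt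
    (h : ∀ d, d ≤ 4 → ∀ P : MvPolynomial (Fin d) ℚ, QuadricBakerDescentAt P) : QuadricFour :=
  fun k d P q ρ c hρ hdeg hd hv =>
    sum_mem_relations_of_bakerDescentAt k d P q ρ c (fun i => h (d i) (hd i) (P i)) hρ hdeg hv

/-! #### Normalisation and closure properties of the class -/

/-- To put `P` in the class it suffices to descend `cellRep P q` for every `q`.
[KontsevichZagier2001 §1.2 rule (1)] -/
theorem bakerDescentAt_of_cellRep {d : ℕ} {P : MvPolynomial (Fin d) ℚ}
    (h : P.totalDegree ≤ 2 → ∀ q : ℚ, ∃ y ∈ AddSubgroup.closure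
      {y : KZ.FormalRep | ∃ (m : ℕ) (N : KZ.IntegralRep m), m ≤ 1 ∧ N.IsRational ∧ y = KZ.of N},
      KZ.of (cellRep P q) - y ∈ KZ.relations) :
    QuadricBakerDescentAt P := by
  intro q ρ hρ hdeg
  obtain ⟨y, hy, hrel⟩ := h hdeg q
  refine ⟨y, hy, ?_⟩
  have : KZ.of ρ - y = (KZ.of ρ - KZ.of (cellRep P q)) + (KZ.of (cellRep P q) - y) := by abel
  rw [this]
  exact add_mem (of_sub_of_cellRep_mem_relations P q ρ hρ) hrel

/-- Conversely a member of the class descends `cellRep P q`. [KontsevichZagier2001 §1.2] -/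
theorem exists_bakerDescent_cellRep {d : ℕ} {P : MvPolynomial (Fin d) ℚ}
    (h : QuadricBakerDescentAt P) (hdeg : P.totalDegree ≤ 2) (q : ℚ) :
    ∃ y ∈ AddSubgroup.closure
      {y : KZ.FormalRep | ∃ (m : ℕ) (N : KZ.IntegralRep m), m ≤ 1 ∧ N.IsRational ∧ y = KZ.of N},
      KZ.of (cellRep P q) - y ∈ KZ.relations :=
  h q (cellRep P q) ⟨cellRep_domain P q, fun x _ => cellRep_integrand P q x⟩ hdeg

/-- **Closure under coordinate permutations** (rule (2), `KZ.permRel`).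
[KontsevichZagier2001 §1.2 rule (2)] -/
theorem bakerDescentAt_rename {d : ℕ} {P : MvPolynomial (Fin d) ℚ} (σ : Equiv.Perm (Fin d))
    (h : QuadricBakerDescentAt P) : QuadricBakerDescentAt (rename σ P) := by
  refine bakerDescentAt_of_cellRep fun hdeg' q => ?_
  have hdeg : P.totalDegree ≤ 2 := (totalDegree_le_totalDegree_rename σ P).trans hdeg'
  set r := cellRep (rename σ P) q with hr
  obtain ⟨y, hy, hrel⟩ := h q (r.reindex σ.symm) (reindex_cellRep_rename σ P q) hdeg
  refine ⟨y, hy, ?_⟩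
  have hperm : KZ.of r - KZ.of (r.reindex σ.symm) ∈ KZ.relations :=
    KZ.permRel_subset_relations (KZ.of_sub_of_reindex_mem_permRel r σ.symm)
  have : KZ.of r - y = (KZ.of r - KZ.of (r.reindex σ.symm)) + (KZ.of (r.reindex σ.symm) - y) := by
    abel
  rw [this]
  exact add_mem hperm hrel

/-- **Closure under the face reflections `xⱼ ↦ 1 − xⱼ`** (rule (2) along the affine involution,
`KZ.of_sub_of_mem_relations_of_boxReflection`). [KontsevichZagier2001 §1.2 rule (2)] -/
theorem bakerDescentAt_reflect {d : ℕ} {P : MvPolynomial (Fin d) ℚ} (j : Fin d)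
    (hdeg : P.totalDegree ≤ 2) (h : QuadricBakerDescentAt P) :
    QuadricBakerDescentAt (bind₁ (KZ.reflectSubst j) P) := by
  refine bakerDescentAt_of_cellRep fun _ q => ?_
  obtain ⟨y, hy, hrel⟩ := exists_bakerDescent_cellRep h hdeg q
  refine ⟨y, hy, ?_⟩
  have hrefl : KZ.of (cellRep (bind₁ (KZ.reflectSubst j) P) q) - KZ.of (cellRep P q) ∈
      KZ.relations :=
    KZ.of_sub_of_mem_relations_of_boxReflection j (cellRep_reflect_domain j P q) fun x _ => by
      rw [cellRep_integrand, cellRep_integrand]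
  have : KZ.of (cellRep (bind₁ (KZ.reflectSubst j) P) q) - y =
      (KZ.of (cellRep (bind₁ (KZ.reflectSubst j) P) q) - KZ.of (cellRep P q)) +
        (KZ.of (cellRep P q) - y) := by abel
  rw [this]
  exact add_mem hrefl hrel

/-- **Closure under cylinders** (one dimension up, the new variable free): collapse the cylinder
by `FourSym.of_cellRep_rename_castSucc_sub_mem_relations` (rules (3), (1a)).
[KontsevichZagier2001 §1.2 rules (1), (3)] -/
theorem bakerDescentAt_cylinder {N : ℕ} {g : MvPolynomial (Fin N) ℚ} (hg : g.totalDegree ≤ 2)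
    (h : QuadricBakerDescentAt g) : QuadricBakerDescentAt (rename Fin.castSucc g) := by
  refine bakerDescentAt_of_cellRep fun _ q => ?_
  obtain ⟨y, hy, hrel⟩ := exists_bakerDescent_cellRep h hg q
  refine ⟨y, hy, ?_⟩
  have : KZ.of (cellRep (rename Fin.castSucc g) q) - y =
      (KZ.of (cellRep (rename Fin.castSucc g) q) - KZ.of (cellRep g q)) +
        (KZ.of (cellRep g q) - y) := by abel
  rw [this]
  exact add_mem (of_cellRep_rename_castSucc_sub_mem_relations g q) hrel

/-- **Degenerate quadric 4-cells are in the class, given item 27597:** for `g` of degree `≤ 2` in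
three variables and any permutation `σ` of the four coordinates,
`QuadricBakerDescent → QuadricBakerDescentAt (rename σ (rename Fin.castSucc g))`.
[KontsevichZagier2001 §1.2; this node] -/
theorem bakerDescentAt_cylinder_four (hB : QuadricBakerDescent) (g : MvPolynomial (Fin 3) ℚ)
    (hg : g.totalDegree ≤ 2) (σ : Equiv.Perm (Fin 4)) :
    QuadricBakerDescentAt (rename σ (rename Fin.castSucc g)) :=
  bakerDescentAt_rename σ (bakerDescentAt_cylinder hg (quadricBakerDescent_iff.mp hB 3 le_rfl g))

end Summit.KontsevichZagierPeriods.RootDecompWalshStrata.BakerAt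

end
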